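import Literature.AnabelianGeometry.SemiGraphs.TemperoidsResProofs
import Literature.AnabelianGeometry.SemiGraphs.TemperoidsHomProofs
import Literature.AlgebraicGeometry.Frobenioids.QuasiTemperoidConnected
import HarnessLib

/-!
# [SemiAnbd] Proposition 3.2 (main statement): `Hom(B^temp Π₁, B^temp Π₂) ≌ ContHom(Π₁, Π₂)` — assembly

Mochizuki, *Semi-graphs of anabelioids*, Publ. RIMS **42** (2006) 221–322, §3, manuscript p. 35,
Proposition 3.2 (whose printed title invokes Grothendieck's anabelian philosophy "for Connected
Temperoids"; a theorem of the paper) [cite: MochizukiSemiAnbd2006, Prop 3.2 p.35]: "the category of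
morphisms `T₁ → T₂` is equivalent to the category whose objects are continuous group homomorphisms
`φ : Π₁ → Π₂` and whose morphisms `φ → ψ` are elements `g ∈ Π₂` such that `γ_g ∘ φ = ψ`" — the named
fact `GCConnectedTemperoids` of `Literature.AnabelianGeometry.SemiGraphs.Temperoids` (seat
abc-iut-L3-t2).

Proof-only companion (no definitions), abc-iut node `SemiAnbd:Prop3.2`, discharge wave 3.  The
equivalence is ASSEMBLED from the landed halves of the cell's division of labour:

* the functor `R : ContHomCat Π₁ Π₂ ⥤ TemperoidHomCat (B^temp Π₁) (B^temp Π₂)`, `φ ↦ B^temp(φ)`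
  (a morphism of temperoids by `ResIsTemperoidHom_holds`, file `TemperoidsHomProofs`, seat L3-d2),
  `g ↦` "act by `g`" (`BTemp.resIsoOfConj`, file `TemperoidsResProofs`, seat L3-t10) — built inside
  the proofs (no definitions in this file);
* `R` is FAITHFUL (two elements acting alike on all the Galois objects `Π₂/N` differ by an element
  of every open normal subgroup, hence are equal: `IsTempered.separated`) and FULL (every natural
  transformation `B^temp(φ) ⟶ B^temp(ψ)` is the action of one `g` with `ψ = γ_g ∘ φ`:
  `BTemp.exists_conj_of_natTrans`, seat L3-t10) — unconditionally (`resFunctor_full_faithful`);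
* `R` is ESSENTIALLY SURJECTIVE exactly when every morphism of temperoids is isomorphic to some
  `B^temp(φ)`, which is the named fact `TemperoidHomEqRes` (Prop. 3.2 "in particular", surjectivity
  half; its discharge is seat L3-d2's item).

Hence the kernel-checked REDUCTION `GCConnectedTemperoids_of_temperoidHomEqRes :
TemperoidHomEqRes Π₁ Π₂ → GCConnectedTemperoids Π₁ Π₂` (a reduction, NOT a discharge: the
hypothesis is a named fact of the statement file; the unconditional `GCConnectedTemperoids_holds`
is appended when `TemperoidHomEqRes_holds` lands).  Plain category theory; no statement of the
paper is strengthened.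
-/

open CategoryTheory CategoryTheory.Limits Topology

namespace Literature.AnabelianGeometry.SemiGraphs

open Literature.AlgebraicGeometry.Frobenioids.QuasiTemperoid.BTempConnected (hom_ext_apply
  ρ_one_apply ρ_mul_apply)

universe u

namespace TemperoidsEquiv

variable {G₁ : Type u} [Group G₁] [TopologicalSpace G₁] [IsTopologicalGroup G₁]
  {G₂ : Type u} [Group G₂] [TopologicalSpace G₂] [IsTopologicalGroup G₂]
  [SecondCountableTopology G₁] [SecondCountableTopology G₂]

/-- **The comparison functor and its full faithfulness.**  For tempered `Π₁, Π₂` there is a functor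
`R : ContHomCat Π₁ Π₂ ⥤ TemperoidHomCat (B^temp Π₁) (B^temp Π₂)` with `R(φ) = B^temp(φ)` on objects,
sending `g : φ → ψ` to the action of `g`, which is full and faithful.
[cite: MochizukiSemiAnbd2006, Prop 3.2 p.35] -/
theorem exists_resFunctor_full_faithful (hG₁ : IsTempered G₁) (hG₂ : IsTempered G₂) :
    ∃ R : ContHomCat G₁ G₂ ⥤ TemperoidHomCat (BTemp G₁) (BTemp G₂),
      (∀ φ : ContHomCat G₁ G₂, (R.obj φ).obj = BTemp.res φ.hom) ∧ R.Full ∧ R.Faithful := by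
  -- the functor
  let R : ContHomCat G₁ G₂ ⥤ TemperoidHomCat (BTemp G₁) (BTemp G₂) :=
    { obj := fun φ => ⟨BTemp.res φ.hom, ResIsTemperoidHom_holds G₁ G₂ hG₁ hG₂ φ.hom⟩
      map := fun {φ ψ} g =>
        ObjectProperty.homMk (BTemp.resIsoOfConj φ.hom ψ.hom g.elt g.conj_eq).hom
      map_id := fun φ => by
        apply ObjectProperty.hom_ext
        ext X : 2
        refine hom_ext_apply fun x => ?_
        change X.obj.ρ 1 x = x
        exact ρ_one_apply X x
      map_comp := fun {φ ψ χ} f g => by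
        apply ObjectProperty.hom_ext
        ext X : 2
        refine hom_ext_apply fun x => ?_
        change X.obj.ρ (g.elt * f.elt) x = X.obj.ρ g.elt (X.obj.ρ f.elt x)
        exact ρ_mul_apply X g.elt f.elt x }
  -- pointwise description of `R.map`
  have hR : ∀ {φ ψ : ContHomCat G₁ G₂} (g : φ ⟶ ψ) (X : BTemp G₂) (x : X.obj.V),
      (((R.map g).hom.app X).hom.hom x : X.obj.V) = X.obj.ρ g.elt x := fun g X x => rfl
  refine ⟨R, fun φ => rfl, ⟨fun {φ ψ} η => ?_⟩, ⟨fun {φ ψ} f f' h => ?_⟩⟩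
  · -- full: `η` is the action of one `g` with `ψ = γ_g ∘ φ`
    obtain ⟨g, hg, hact⟩ := BTemp.exists_conj_of_natTrans hG₂ φ.hom ψ.hom η.hom
    refine ⟨⟨g, hg⟩, ?_⟩
    apply ObjectProperty.hom_ext
    ext X : 2
    refine hom_ext_apply fun x => ?_
    rw [hact X x]
    exact hR _ X x
  · -- faithful: compare the actions on the Galois objects `Π₂/N`
    apply ContHomCat.Hom.ext
    by_contra hne
    have hne' : f.elt⁻¹ * f'.elt ≠ 1 := fun h1 => hne (by
      rw [← mul_inv_cancel_left f.elt f'.elt]  -- f.elt * (f.elt⁻¹ * f'.elt) = f'.elt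
      rw [h1, mul_one])
    obtain ⟨N, hN⟩ := hG₂.separated _ hne'
    apply hN
    have h1 := congrArg (fun η : R.obj φ ⟶ R.obj ψ =>
      ((η.hom.app (BTemp.Q hG₂ N)).hom.hom ((1 : G₂) : G₂ ⧸ N.toSubgroup) : G₂ ⧸ N.toSubgroup)) h
    simp only at h1
    rw [hR, hR, BTemp.Q_ρ_apply, BTemp.Q_ρ_apply, mul_one, mul_one] at h1
    -- h1 : (f.elt : Π₂/N) = f'.elt
    exact QuotientGroup.eq.mp h1

end TemperoidsEquiv

open TemperoidsEquiv in
/-- **[SemiAnbd] Proposition 3.2, main statement — REDUCTION** to its surjectivity half: if every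
morphism of temperoids `B^temp(Π₁) → B^temp(Π₂)` is isomorphic to some `B^temp(φ)` (the named fact
`TemperoidHomEqRes`), then the category of morphisms `B^temp(Π₁) → B^temp(Π₂)` is equivalent to
`ContHomCat Π₁ Π₂` (the named fact `GCConnectedTemperoids`): the comparison functor is then fully
faithful and essentially surjective.  (A reduction, not a discharge; the unconditional statement
follows when `TemperoidHomEqRes_holds` lands.) [cite: MochizukiSemiAnbd2006, Prop 3.2 p.35] -/
theorem GCConnectedTemperoids_of_temperoidHomEqRes :
    ∀ (G₁ : Type u) [Group G₁] [TopologicalSpace G₁] (G₂ : Type u) [Group G₂]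
      [TopologicalSpace G₂], TemperoidHomEqRes G₁ G₂ → GCConnectedTemperoids G₁ G₂ := by
  intro G₁ _ _ G₂ _ _ h _ _ _ _ hG₁ hG₂
  obtain ⟨R, hRobj, hfull, hfaithful⟩ := exists_resFunctor_full_faithful hG₁ hG₂
  haveI := hfull
  haveI := hfaithful
  haveI : R.EssSurj := ⟨fun Φ => by
    obtain ⟨φ, ⟨e⟩⟩ := h hG₁ hG₂ ⟨Φ.obj, Φ.property.1, Φ.property.2⟩
    -- `e : Φ.obj ≅ BTemp.res φ = (R.obj ⟨φ⟩).obj`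
    refine ⟨⟨φ⟩, ⟨ObjectProperty.isoMk _ ?_⟩⟩
    rw [hRobj]
    exact e.symm⟩
  haveI : R.IsEquivalence := { }
  exact ⟨R.asEquivalence.symm⟩

end Literature.AnabelianGeometry.SemiGraphs
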